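import Summits.ValiantsHypothesis.ValiantsHypothesis.Theorems.KPlusLogSqLawTridiagonalRealStaticPumpStep
import Summits.ValiantsHypothesis.ValiantsHypothesis.Theorems.KPlusLogSqLawTridiagonalRealStatic

/-!
# Route «KPlusLogSqLaw», crux `WeakLifting` (stmt-ValiantsHypothesis-19561) — REAL side of the tridiagonal sector:
# path determinants with vertex exponents, and the size-4 BASE of the analytic pump

HONEST FRAMING.  Helper (`--supports stmt-ValiantsHypothesis-19561 --as helper`), seat val-sym-lift-p1 (g12), cell `pub-symmetroid`,
2026-08-27.  Bookkeeping for the analytic pump (companion of `…PumpStep`):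
* the continuants of a static symmetric tridiagonal monomial matrix with diagonal entries `X^{e_t}` and links `b_t X^{f_t}` are the
  determinants of `ctPath (X^{e_t}) (b_t X^{f_t}) (b_{t−1} X^{f_{t−1}})`; `eval_det_epath_add_two` is the recurrence
  `D_{n+2}(x) = x^{e_{n+1}} D_{n+1}(x) − b_n² x^{2 f_n} D_n(x)` (via the tree's `det_ctPath`), with `D₀ = 1`, `D₁ = x^{e₀}`, data-agreement and
  continuity lemmas — both pump moves are instances: type I (`e_{n+1} = 0`, `f_n` large) and type II (`e_{n+1}` large, `f_n = 0`);
* `pump_base`: the explicit size-4 design `e = (0,0,1,0)`, links `(1·X, ½·X⁰, 2·X²)`, i.e. `D₂ = 1 − x²`, `D₃ = x − x³ − ¼`,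
  `D₄ = D₃ − 4x⁴(1 − x²)` (zeros interleave as `p q q p q`: `0.2696 | 0.3217, 0.3999 | 0.8376 | 1.0346`), satisfies the 17-clause pump
  invariant of `…PumpStep` in REFLECTED form (next move of type II): functions `z ↦ D₃(−z)`, `z ↦ D₄(−z)`, signs `s = μ = 1`, sample points
  `−6/5 < −19/20 < −9/10 < (R = []) < −3/5 < (T = [−9/25]) < −29/100 < −7/25 < −1/5`; the two no-zero clauses are elementary estimates
  (`D₃ < 0` on `[0.9, 1.2]`; `D₄ < 0` on `[0.2, 0.29]` by four monotone boxes).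
Nothing here is an upper bound; nothing bears on `WeakLifting` / `TropicalB` in their windows, Conjecture B, the doors, `MatrixDescartes`
(stmt-18050) or VP ≠ VNP.  [folklore: continuants; data of this seat]
-/

-- `Summit.ValiantsHypothesis.ValiantsHypothesis.…` repeats a component by the D-0017 layout (single-conjunct summit); the name is mandated.
set_option linter.dupNamespace false
set_option autoImplicit false

namespace Summit.ValiantsHypothesis.ValiantsHypothesis.Theorems.KPlusLogSqLaw.StaticTridiagonalRealLadder

open Polynomial
open Summit.ValiantsHypothesis.ValiantsHypothesis.Theorems.ValuativeFlip (ctK ctPath ctPath_apply ctK_zero ctK_one ctK_add_two)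
open Summit.ValiantsHypothesis.ValiantsHypothesis.Theorems.KPlusLogSqLaw.StaticTridiagonalReal (det_ctPath)

/-! ### Path determinants with vertex exponents -/

/-- **Three-term recurrence** with vertex exponents: `D_{n+2}(x) = x^{e_{n+1}}·D_{n+1}(x) − b_n² x^{2 f_n}·D_n(x)`. [folklore: continuants] -/
theorem eval_det_epath_add_two (e : ℕ → ℕ) (b : ℕ → ℝ) (f : ℕ → ℕ) (n : ℕ) (x : ℝ) :
    (((ctPath (fun t => (X : ℝ[X]) ^ e t) (fun t => C (b t) * X ^ f t) (fun t => C (b (t - 1)) * X ^ f (t - 1)) (n + 2))).det).eval x =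
      x ^ e (n + 1) * (((ctPath (fun t => (X : ℝ[X]) ^ e t) (fun t => C (b t) * X ^ f t) (fun t => C (b (t - 1)) * X ^ f (t - 1)) (n + 1))).det).eval x - b n ^ 2 * x ^ (2 * f n) * (((ctPath (fun t => (X : ℝ[X]) ^ e t) (fun t => C (b t) * X ^ f t) (fun t => C (b (t - 1)) * X ^ f (t - 1)) n)).det).eval x := by
  rw [det_ctPath _ _ _ (n + 2), det_ctPath _ _ _ (n + 1), det_ctPath _ _ _ n, ctK_add_two]
  simp only [Nat.add_sub_cancel, eval_add, eval_mul, eval_X, eval_neg, eval_C, eval_pow]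
  ring

/-- `D₀ = 1`. [folklore] -/
theorem eval_det_epath_zero (e : ℕ → ℕ) (b : ℕ → ℝ) (f : ℕ → ℕ) (x : ℝ) : (((ctPath (fun t => (X : ℝ[X]) ^ e t) (fun t => C (b t) * X ^ f t) (fun t => C (b (t - 1)) * X ^ f (t - 1)) 0)).det).eval x = 1 := by
  rw [Matrix.det_isEmpty, eval_one]

/-- `D₁ = x^{e₀}`. [folklore] -/
theorem eval_det_epath_one (e : ℕ → ℕ) (b : ℕ → ℝ) (f : ℕ → ℕ) (x : ℝ) : (((ctPath (fun t => (X : ℝ[X]) ^ e t) (fun t => C (b t) * X ^ f t) (fun t => C (b (t - 1)) * X ^ f (t - 1)) 1)).det).eval x = x ^ e 0 := by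
  rw [det_ctPath _ _ _ 1, ctK_one, eval_pow, eval_X]

/-- The path matrix of size `n` only depends on `e_t` (`t < n`) and on the link data `b_t, f_t` (`t + 1 < n`). [folklore] -/
theorem ctPath_congr_edata {e e' : ℕ → ℕ} {b b' : ℕ → ℝ} {f f' : ℕ → ℕ} {n : ℕ} (he : ∀ t, t < n → e t = e' t)
    (hb : ∀ t, t + 1 < n → b t = b' t) (hf : ∀ t, t + 1 < n → f t = f' t) :
    (ctPath (fun t => (X : ℝ[X]) ^ e t) (fun t => C (b t) * X ^ f t) (fun t => C (b (t - 1)) * X ^ f (t - 1)) n) =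
      (ctPath (fun t => (X : ℝ[X]) ^ e' t) (fun t => C (b' t) * X ^ f' t) (fun t => C (b' (t - 1)) * X ^ f' (t - 1)) n) := by
  ext x y
  have hx := x.isLt
  have hy := y.isLt
  simp only [ctPath_apply]
  split_ifs with h1 h2 h3
  · rw [he x hx]
  · rw [hb x (by omega), hf x (by omega)]
  · rw [hb (x - 1) (by omega), hf (x - 1) (by omega)]
  · rfl

/-- continuity of `z ↦ D_n(ρ z)`. [folklore] -/
theorem continuous_eval_det_epath (e : ℕ → ℕ) (b : ℕ → ℝ) (f : ℕ → ℕ) (n : ℕ) (ρ : ℝ) :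
    Continuous fun z : ℝ => (((ctPath (fun t => (X : ℝ[X]) ^ e t) (fun t => C (b t) * X ^ f t) (fun t => C (b (t - 1)) * X ^ f (t - 1)) n)).det).eval (ρ * z) :=
  (Polynomial.continuous _).comp (continuous_const.mul continuous_id)

/-! ### The base: size 4 -/

/-- `D₁ = 1` for the base data. [data of this seat] -/
theorem eval_det_pbase_one (x : ℝ) : (((ctPath (fun t => (X : ℝ[X]) ^ (fun t : ℕ => if t = 2 then (1 : ℕ) else 0) t) (fun t => C ((fun t : ℕ => if t = 0 then (1 : ℝ) else if t = 1 then 1 / 2 else 2) t) * X ^ (fun t : ℕ => if t = 0 then (1 : ℕ) else if t = 1 then 0 else 2) t) (fun t => C ((fun t : ℕ => if t = 0 then (1 : ℝ) else if t = 1 then 1 / 2 else 2) (t - 1)) * X ^ (fun t : ℕ => if t = 0 then (1 : ℕ) else if t = 1 then 0 else 2) (t - 1)) 1)).det).eval x = 1 := by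
  rw [eval_det_epath_one]; simp

/-- `D₂ = 1 − x²` for the base data. [data of this seat] -/
theorem eval_det_pbase_two (x : ℝ) : (((ctPath (fun t => (X : ℝ[X]) ^ (fun t : ℕ => if t = 2 then (1 : ℕ) else 0) t) (fun t => C ((fun t : ℕ => if t = 0 then (1 : ℝ) else if t = 1 then 1 / 2 else 2) t) * X ^ (fun t : ℕ => if t = 0 then (1 : ℕ) else if t = 1 then 0 else 2) t) (fun t => C ((fun t : ℕ => if t = 0 then (1 : ℝ) else if t = 1 then 1 / 2 else 2) (t - 1)) * X ^ (fun t : ℕ => if t = 0 then (1 : ℕ) else if t = 1 then 0 else 2) (t - 1)) 2)).det).eval x = 1 - x ^ 2 := by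
  have h := eval_det_epath_add_two (fun t : ℕ => if t = 2 then (1 : ℕ) else 0) (fun t : ℕ => if t = 0 then (1 : ℝ) else if t = 1 then 1 / 2 else 2) (fun t : ℕ => if t = 0 then (1 : ℕ) else if t = 1 then 0 else 2) 0 x
  have h1 : (((ctPath (fun t => (X : ℝ[X]) ^ (fun t : ℕ => if t = 2 then (1 : ℕ) else 0) t) (fun t => C ((fun t : ℕ => if t = 0 then (1 : ℝ) else if t = 1 then 1 / 2 else 2) t) * X ^ (fun t : ℕ => if t = 0 then (1 : ℕ) else if t = 1 then 0 else 2) t) (fun t => C ((fun t : ℕ => if t = 0 then (1 : ℝ) else if t = 1 then 1 / 2 else 2) (t - 1)) * X ^ (fun t : ℕ => if t = 0 then (1 : ℕ) else if t = 1 then 0 else 2) (t - 1)) (0 + 1))).det).eval x = 1 := eval_det_pbase_one x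
  rw [h1, eval_det_epath_zero] at h
  have h2 : (((ctPath (fun t => (X : ℝ[X]) ^ (fun t : ℕ => if t = 2 then (1 : ℕ) else 0) t) (fun t => C ((fun t : ℕ => if t = 0 then (1 : ℝ) else if t = 1 then 1 / 2 else 2) t) * X ^ (fun t : ℕ => if t = 0 then (1 : ℕ) else if t = 1 then 0 else 2) t) (fun t => C ((fun t : ℕ => if t = 0 then (1 : ℝ) else if t = 1 then 1 / 2 else 2) (t - 1)) * X ^ (fun t : ℕ => if t = 0 then (1 : ℕ) else if t = 1 then 0 else 2) (t - 1)) 2)).det).eval x = (((ctPath (fun t => (X : ℝ[X]) ^ (fun t : ℕ => if t = 2 then (1 : ℕ) else 0) t) (fun t => C ((fun t : ℕ => if t = 0 then (1 : ℝ) else if t = 1 then 1 / 2 else 2) t) * X ^ (fun t : ℕ => if t = 0 then (1 : ℕ) else if t = 1 then 0 else 2) t) (fun t => C ((fun t : ℕ => if t = 0 then (1 : ℝ) else if t = 1 then 1 / 2 else 2) (t - 1)) * X ^ (fun t : ℕ => if t = 0 then (1 : ℕ) else if t = 1 then 0 else 2) (t - 1)) (0 + 2))).det).eval x := rfl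
  rw [h2, h]
  norm_num

/-- `D₃ = x − x³ − 1/4` for the base data. [data of this seat] -/
theorem eval_det_pbase_three (x : ℝ) : (((ctPath (fun t => (X : ℝ[X]) ^ (fun t : ℕ => if t = 2 then (1 : ℕ) else 0) t) (fun t => C ((fun t : ℕ => if t = 0 then (1 : ℝ) else if t = 1 then 1 / 2 else 2) t) * X ^ (fun t : ℕ => if t = 0 then (1 : ℕ) else if t = 1 then 0 else 2) t) (fun t => C ((fun t : ℕ => if t = 0 then (1 : ℝ) else if t = 1 then 1 / 2 else 2) (t - 1)) * X ^ (fun t : ℕ => if t = 0 then (1 : ℕ) else if t = 1 then 0 else 2) (t - 1)) 3)).det).eval x = x - x ^ 3 - 1 / 4 := by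
  have h := eval_det_epath_add_two (fun t : ℕ => if t = 2 then (1 : ℕ) else 0) (fun t : ℕ => if t = 0 then (1 : ℝ) else if t = 1 then 1 / 2 else 2) (fun t : ℕ => if t = 0 then (1 : ℕ) else if t = 1 then 0 else 2) 1 x
  have h1 : (((ctPath (fun t => (X : ℝ[X]) ^ (fun t : ℕ => if t = 2 then (1 : ℕ) else 0) t) (fun t => C ((fun t : ℕ => if t = 0 then (1 : ℝ) else if t = 1 then 1 / 2 else 2) t) * X ^ (fun t : ℕ => if t = 0 then (1 : ℕ) else if t = 1 then 0 else 2) t) (fun t => C ((fun t : ℕ => if t = 0 then (1 : ℝ) else if t = 1 then 1 / 2 else 2) (t - 1)) * X ^ (fun t : ℕ => if t = 0 then (1 : ℕ) else if t = 1 then 0 else 2) (t - 1)) (1 + 1))).det).eval x = 1 - x ^ 2 := eval_det_pbase_two x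
  rw [h1, eval_det_pbase_one] at h
  have h2 : (((ctPath (fun t => (X : ℝ[X]) ^ (fun t : ℕ => if t = 2 then (1 : ℕ) else 0) t) (fun t => C ((fun t : ℕ => if t = 0 then (1 : ℝ) else if t = 1 then 1 / 2 else 2) t) * X ^ (fun t : ℕ => if t = 0 then (1 : ℕ) else if t = 1 then 0 else 2) t) (fun t => C ((fun t : ℕ => if t = 0 then (1 : ℝ) else if t = 1 then 1 / 2 else 2) (t - 1)) * X ^ (fun t : ℕ => if t = 0 then (1 : ℕ) else if t = 1 then 0 else 2) (t - 1)) 3)).det).eval x = (((ctPath (fun t => (X : ℝ[X]) ^ (fun t : ℕ => if t = 2 then (1 : ℕ) else 0) t) (fun t => C ((fun t : ℕ => if t = 0 then (1 : ℝ) else if t = 1 then 1 / 2 else 2) t) * X ^ (fun t : ℕ => if t = 0 then (1 : ℕ) else if t = 1 then 0 else 2) t) (fun t => C ((fun t : ℕ => if t = 0 then (1 : ℝ) else if t = 1 then 1 / 2 else 2) (t - 1)) * X ^ (fun t : ℕ => if t = 0 then (1 : ℕ) else if t = 1 then 0 else 2) (t - 1)) (1 + 2))).det).eval x := rfl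
  rw [h2, h]
  norm_num; ring

/-- `D₄ = x − x³ − 1/4 − 4x⁴ + 4x⁶` for the base data. [data of this seat] -/
theorem eval_det_pbase_four (x : ℝ) : (((ctPath (fun t => (X : ℝ[X]) ^ (fun t : ℕ => if t = 2 then (1 : ℕ) else 0) t) (fun t => C ((fun t : ℕ => if t = 0 then (1 : ℝ) else if t = 1 then 1 / 2 else 2) t) * X ^ (fun t : ℕ => if t = 0 then (1 : ℕ) else if t = 1 then 0 else 2) t) (fun t => C ((fun t : ℕ => if t = 0 then (1 : ℝ) else if t = 1 then 1 / 2 else 2) (t - 1)) * X ^ (fun t : ℕ => if t = 0 then (1 : ℕ) else if t = 1 then 0 else 2) (t - 1)) 4)).det).eval x = x - x ^ 3 - 1 / 4 - 4 * x ^ 4 + 4 * x ^ 6 := by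
  have h := eval_det_epath_add_two (fun t : ℕ => if t = 2 then (1 : ℕ) else 0) (fun t : ℕ => if t = 0 then (1 : ℝ) else if t = 1 then 1 / 2 else 2) (fun t : ℕ => if t = 0 then (1 : ℕ) else if t = 1 then 0 else 2) 2 x
  have h1 : (((ctPath (fun t => (X : ℝ[X]) ^ (fun t : ℕ => if t = 2 then (1 : ℕ) else 0) t) (fun t => C ((fun t : ℕ => if t = 0 then (1 : ℝ) else if t = 1 then 1 / 2 else 2) t) * X ^ (fun t : ℕ => if t = 0 then (1 : ℕ) else if t = 1 then 0 else 2) t) (fun t => C ((fun t : ℕ => if t = 0 then (1 : ℝ) else if t = 1 then 1 / 2 else 2) (t - 1)) * X ^ (fun t : ℕ => if t = 0 then (1 : ℕ) else if t = 1 then 0 else 2) (t - 1)) (2 + 1))).det).eval x = x - x ^ 3 - 1 / 4 := eval_det_pbase_three x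
  have h2 : (((ctPath (fun t => (X : ℝ[X]) ^ (fun t : ℕ => if t = 2 then (1 : ℕ) else 0) t) (fun t => C ((fun t : ℕ => if t = 0 then (1 : ℝ) else if t = 1 then 1 / 2 else 2) t) * X ^ (fun t : ℕ => if t = 0 then (1 : ℕ) else if t = 1 then 0 else 2) t) (fun t => C ((fun t : ℕ => if t = 0 then (1 : ℝ) else if t = 1 then 1 / 2 else 2) (t - 1)) * X ^ (fun t : ℕ => if t = 0 then (1 : ℕ) else if t = 1 then 0 else 2) (t - 1)) 2)).det).eval x = 1 - x ^ 2 := eval_det_pbase_two x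
  rw [h1, h2] at h
  have h3 : (((ctPath (fun t => (X : ℝ[X]) ^ (fun t : ℕ => if t = 2 then (1 : ℕ) else 0) t) (fun t => C ((fun t : ℕ => if t = 0 then (1 : ℝ) else if t = 1 then 1 / 2 else 2) t) * X ^ (fun t : ℕ => if t = 0 then (1 : ℕ) else if t = 1 then 0 else 2) t) (fun t => C ((fun t : ℕ => if t = 0 then (1 : ℝ) else if t = 1 then 1 / 2 else 2) (t - 1)) * X ^ (fun t : ℕ => if t = 0 then (1 : ℕ) else if t = 1 then 0 else 2) (t - 1)) 4)).det).eval x = (((ctPath (fun t => (X : ℝ[X]) ^ (fun t : ℕ => if t = 2 then (1 : ℕ) else 0) t) (fun t => C ((fun t : ℕ => if t = 0 then (1 : ℝ) else if t = 1 then 1 / 2 else 2) t) * X ^ (fun t : ℕ => if t = 0 then (1 : ℕ) else if t = 1 then 0 else 2) t) (fun t => C ((fun t : ℕ => if t = 0 then (1 : ℝ) else if t = 1 then 1 / 2 else 2) (t - 1)) * X ^ (fun t : ℕ => if t = 0 then (1 : ℕ) else if t = 1 then 0 else 2) (t - 1)) (2 + 2))).det).eval x := rfl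
  rw [h3, h]
  norm_num; ring

/-- `D₃ < 0` on `[9/10, 6/5]` (no zero of the older base continuant near the near end). [data of this seat] -/
theorem pbase_three_neg {u : ℝ} (hu : u ∈ Set.Icc (9 / 10 : ℝ) (6 / 5)) : u - u ^ 3 - 1 / 4 < 0 := by
  obtain ⟨h1, h2⟩ := hu
  have hsq : (81 / 100 : ℝ) ≤ u ^ 2 := by nlinarith
  nlinarith

/-- monotone box estimate for `D₄` on `[a, b] ⊆ [0, 1]`. [data of this seat] -/
theorem pbase_four_box {a c u : ℝ} (ha : 0 ≤ a) (hu : u ∈ Set.Icc a c)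
    (hnum : c - a ^ 3 - 1 / 4 - 4 * a ^ 4 + 4 * c ^ 6 < 0) : u - u ^ 3 - 1 / 4 - 4 * u ^ 4 + 4 * u ^ 6 < 0 := by
  obtain ⟨h1, h2⟩ := hu
  have hu0 : 0 ≤ u := ha.trans h1
  have e3 : a ^ 3 ≤ u ^ 3 := pow_le_pow_left₀ ha h1 3
  have e4 : a ^ 4 ≤ u ^ 4 := pow_le_pow_left₀ ha h1 4
  have e6 : u ^ 6 ≤ c ^ 6 := pow_le_pow_left₀ hu0 h2 6
  linarith

/-- `D₄ < 0` on `[1/5, 29/100]` (no zero of the newer base continuant near the far end): four boxes. [data of this seat] -/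
theorem pbase_four_neg {u : ℝ} (hu : u ∈ Set.Icc (1 / 5 : ℝ) (29 / 100)) : u - u ^ 3 - 1 / 4 - 4 * u ^ 4 + 4 * u ^ 6 < 0 := by
  obtain ⟨h1, h2⟩ := hu
  by_cases ha : u ≤ 6 / 25
  · exact pbase_four_box (a := 1 / 5) (c := 6 / 25) (by norm_num) ⟨h1, ha⟩ (by norm_num)
  by_cases hb : u ≤ 269 / 1000
  · exact pbase_four_box (a := 6 / 25) (c := 269 / 1000) (by norm_num) ⟨by linarith, hb⟩ (by norm_num)
  by_cases hc : u ≤ 7 / 25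
  · exact pbase_four_box (a := 269 / 1000) (c := 7 / 25) (by norm_num) ⟨by linarith, hc⟩ (by norm_num)
  · exact pbase_four_box (a := 7 / 25) (c := 29 / 100) (by norm_num) ⟨by linarith, h2⟩ (by norm_num)

/-- **THE BASE STATE OF THE PUMP** (size 4, reflected form, `s = μ = 1`; module docstring). [data of this seat] -/
theorem pump_base :
    ((-(6 / 5 : ℝ)) :: (-(19 / 20 : ℝ)) :: (-(9 / 10 : ℝ)) :: (([] : List ℝ) ++ (-(3 / 5 : ℝ)) :: (([-(9 / 25 : ℝ)] : List ℝ) ++ [(-(29 / 100 : ℝ)), (-(7 / 25 : ℝ)), (-(1 / 5 : ℝ))]))).IsChain (· < ·) ∧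
      0 < (1 : ℝ) * (fun z : ℝ => (((ctPath (fun t => (X : ℝ[X]) ^ (fun t : ℕ => if t = 2 then (1 : ℕ) else 0) t) (fun t => C ((fun t : ℕ => if t = 0 then (1 : ℝ) else if t = 1 then 1 / 2 else 2) t) * X ^ (fun t : ℕ => if t = 0 then (1 : ℕ) else if t = 1 then 0 else 2) t) (fun t => C ((fun t : ℕ => if t = 0 then (1 : ℝ) else if t = 1 then 1 / 2 else 2) (t - 1)) * X ^ (fun t : ℕ => if t = 0 then (1 : ℕ) else if t = 1 then 0 else 2) (t - 1)) 4)).det).eval ((-1 : ℝ) * z)) (-(6 / 5 : ℝ)) ∧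
      (1 : ℝ) * (fun z : ℝ => (((ctPath (fun t => (X : ℝ[X]) ^ (fun t : ℕ => if t = 2 then (1 : ℕ) else 0) t) (fun t => C ((fun t : ℕ => if t = 0 then (1 : ℝ) else if t = 1 then 1 / 2 else 2) t) * X ^ (fun t : ℕ => if t = 0 then (1 : ℕ) else if t = 1 then 0 else 2) t) (fun t => C ((fun t : ℕ => if t = 0 then (1 : ℝ) else if t = 1 then 1 / 2 else 2) (t - 1)) * X ^ (fun t : ℕ => if t = 0 then (1 : ℕ) else if t = 1 then 0 else 2) (t - 1)) 4)).det).eval ((-1 : ℝ) * z)) (-(19 / 20 : ℝ)) < 0 ∧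
      (1 : ℝ) * (fun z : ℝ => (((ctPath (fun t => (X : ℝ[X]) ^ (fun t : ℕ => if t = 2 then (1 : ℕ) else 0) t) (fun t => C ((fun t : ℕ => if t = 0 then (1 : ℝ) else if t = 1 then 1 / 2 else 2) t) * X ^ (fun t : ℕ => if t = 0 then (1 : ℕ) else if t = 1 then 0 else 2) t) (fun t => C ((fun t : ℕ => if t = 0 then (1 : ℝ) else if t = 1 then 1 / 2 else 2) (t - 1)) * X ^ (fun t : ℕ => if t = 0 then (1 : ℕ) else if t = 1 then 0 else 2) (t - 1)) 4)).det).eval ((-1 : ℝ) * z)) (-(9 / 10 : ℝ)) < 0 ∧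
      (∀ r ∈ ([] : List ℝ), (1 : ℝ) * (fun z : ℝ => (((ctPath (fun t => (X : ℝ[X]) ^ (fun t : ℕ => if t = 2 then (1 : ℕ) else 0) t) (fun t => C ((fun t : ℕ => if t = 0 then (1 : ℝ) else if t = 1 then 1 / 2 else 2) t) * X ^ (fun t : ℕ => if t = 0 then (1 : ℕ) else if t = 1 then 0 else 2) t) (fun t => C ((fun t : ℕ => if t = 0 then (1 : ℝ) else if t = 1 then 1 / 2 else 2) (t - 1)) * X ^ (fun t : ℕ => if t = 0 then (1 : ℕ) else if t = 1 then 0 else 2) (t - 1)) 4)).det).eval ((-1 : ℝ) * z)) r < 0) ∧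
      (1 : ℝ) * (fun z : ℝ => (((ctPath (fun t => (X : ℝ[X]) ^ (fun t : ℕ => if t = 2 then (1 : ℕ) else 0) t) (fun t => C ((fun t : ℕ => if t = 0 then (1 : ℝ) else if t = 1 then 1 / 2 else 2) t) * X ^ (fun t : ℕ => if t = 0 then (1 : ℕ) else if t = 1 then 0 else 2) t) (fun t => C ((fun t : ℕ => if t = 0 then (1 : ℝ) else if t = 1 then 1 / 2 else 2) (t - 1)) * X ^ (fun t : ℕ => if t = 0 then (1 : ℕ) else if t = 1 then 0 else 2) (t - 1)) 4)).det).eval ((-1 : ℝ) * z)) (-(3 / 5 : ℝ)) < 0 ∧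
      ((-(3 / 5 : ℝ)) :: (([-(9 / 25 : ℝ)] : List ℝ) ++ [(-(29 / 100 : ℝ))])).IsChain (fun a b => (fun z : ℝ => (((ctPath (fun t => (X : ℝ[X]) ^ (fun t : ℕ => if t = 2 then (1 : ℕ) else 0) t) (fun t => C ((fun t : ℕ => if t = 0 then (1 : ℝ) else if t = 1 then 1 / 2 else 2) t) * X ^ (fun t : ℕ => if t = 0 then (1 : ℕ) else if t = 1 then 0 else 2) t) (fun t => C ((fun t : ℕ => if t = 0 then (1 : ℝ) else if t = 1 then 1 / 2 else 2) (t - 1)) * X ^ (fun t : ℕ => if t = 0 then (1 : ℕ) else if t = 1 then 0 else 2) (t - 1)) 4)).det).eval ((-1 : ℝ) * z)) a * (fun z : ℝ => (((ctPath (fun t => (X : ℝ[X]) ^ (fun t : ℕ => if t = 2 then (1 : ℕ) else 0) t) (fun t => C ((fun t : ℕ => if t = 0 then (1 : ℝ) else if t = 1 then 1 / 2 else 2) t) * X ^ (fun t : ℕ => if t = 0 then (1 : ℕ) else if t = 1 then 0 else 2) t) (fun t => C ((fun t : ℕ => if t = 0 then (1 : ℝ) else if t = 1 then 1 / 2 else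 2) (t - 1)) * X ^ (fun t : ℕ => if t = 0 then (1 : ℕ) else if t = 1 then 0 else 2) (t - 1)) 4)).det).eval ((-1 : ℝ) * z)) b < 0) ∧
      (1 : ℝ) * (fun z : ℝ => (((ctPath (fun t => (X : ℝ[X]) ^ (fun t : ℕ => if t = 2 then (1 : ℕ) else 0) t) (fun t => C ((fun t : ℕ => if t = 0 then (1 : ℝ) else if t = 1 then 1 / 2 else 2) t) * X ^ (fun t : ℕ => if t = 0 then (1 : ℕ) else if t = 1 then 0 else 2) t) (fun t => C ((fun t : ℕ => if t = 0 then (1 : ℝ) else if t = 1 then 1 / 2 else 2) (t - 1)) * X ^ (fun t : ℕ => if t = 0 then (1 : ℕ) else if t = 1 then 0 else 2) (t - 1)) 4)).det).eval ((-1 : ℝ) * z)) (-(29 / 100 : ℝ)) < 0 ∧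
      (1 : ℝ) * (fun z : ℝ => (((ctPath (fun t => (X : ℝ[X]) ^ (fun t : ℕ => if t = 2 then (1 : ℕ) else 0) t) (fun t => C ((fun t : ℕ => if t = 0 then (1 : ℝ) else if t = 1 then 1 / 2 else 2) t) * X ^ (fun t : ℕ => if t = 0 then (1 : ℕ) else if t = 1 then 0 else 2) t) (fun t => C ((fun t : ℕ => if t = 0 then (1 : ℝ) else if t = 1 then 1 / 2 else 2) (t - 1)) * X ^ (fun t : ℕ => if t = 0 then (1 : ℕ) else if t = 1 then 0 else 2) (t - 1)) 3)).det).eval ((-1 : ℝ) * z)) (-(9 / 10 : ℝ)) < 0 ∧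
      ((-(9 / 10 : ℝ)) :: (([] : List ℝ) ++ [(-(3 / 5 : ℝ))])).IsChain (fun a b => (fun z : ℝ => (((ctPath (fun t => (X : ℝ[X]) ^ (fun t : ℕ => if t = 2 then (1 : ℕ) else 0) t) (fun t => C ((fun t : ℕ => if t = 0 then (1 : ℝ) else if t = 1 then 1 / 2 else 2) t) * X ^ (fun t : ℕ => if t = 0 then (1 : ℕ) else if t = 1 then 0 else 2) t) (fun t => C ((fun t : ℕ => if t = 0 then (1 : ℝ) else if t = 1 then 1 / 2 else 2) (t - 1)) * X ^ (fun t : ℕ => if t = 0 then (1 : ℕ) else if t = 1 then 0 else 2) (t - 1)) 3)).det).eval ((-1 : ℝ) * z)) a * (fun z : ℝ => (((ctPath (fun t => (X : ℝ[X]) ^ (fun t : ℕ => if t = 2 then (1 : ℕ) else 0) t) (fun t => C ((fun t : ℕ => if t = 0 then (1 : ℝ) else if t = 1 then 1 / 2 else 2) t) * X ^ (fun t : ℕ => if t = 0 then (1 : ℕ) else if t = 1 then 0 else 2) t) (fun t => C ((fun t : ℕ => if t = 0 then (1 : ℝ) else if t = 1 then 1 / 2 else 2) (t - 1)) * X ^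 (fun t : ℕ => if t = 0 then (1 : ℕ) else if t = 1 then 0 else 2) (t - 1)) 3)).det).eval ((-1 : ℝ) * z)) b < 0) ∧
      0 < (1 : ℝ) * (fun z : ℝ => (((ctPath (fun t => (X : ℝ[X]) ^ (fun t : ℕ => if t = 2 then (1 : ℕ) else 0) t) (fun t => C ((fun t : ℕ => if t = 0 then (1 : ℝ) else if t = 1 then 1 / 2 else 2) t) * X ^ (fun t : ℕ => if t = 0 then (1 : ℕ) else if t = 1 then 0 else 2) t) (fun t => C ((fun t : ℕ => if t = 0 then (1 : ℝ) else if t = 1 then 1 / 2 else 2) (t - 1)) * X ^ (fun t : ℕ => if t = 0 then (1 : ℕ) else if t = 1 then 0 else 2) (t - 1)) 3)).det).eval ((-1 : ℝ) * z)) (-(3 / 5 : ℝ)) ∧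
      (∀ t ∈ ([-(9 / 25 : ℝ)] : List ℝ), 0 < (1 : ℝ) * (fun z : ℝ => (((ctPath (fun t => (X : ℝ[X]) ^ (fun t : ℕ => if t = 2 then (1 : ℕ) else 0) t) (fun t => C ((fun t : ℕ => if t = 0 then (1 : ℝ) else if t = 1 then 1 / 2 else 2) t) * X ^ (fun t : ℕ => if t = 0 then (1 : ℕ) else if t = 1 then 0 else 2) t) (fun t => C ((fun t : ℕ => if t = 0 then (1 : ℝ) else if t = 1 then 1 / 2 else 2) (t - 1)) * X ^ (fun t : ℕ => if t = 0 then (1 : ℕ) else if t = 1 then 0 else 2) (t - 1)) 3)).det).eval ((-1 : ℝ) * z)) t) ∧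
      0 < (1 : ℝ) * (fun z : ℝ => (((ctPath (fun t => (X : ℝ[X]) ^ (fun t : ℕ => if t = 2 then (1 : ℕ) else 0) t) (fun t => C ((fun t : ℕ => if t = 0 then (1 : ℝ) else if t = 1 then 1 / 2 else 2) t) * X ^ (fun t : ℕ => if t = 0 then (1 : ℕ) else if t = 1 then 0 else 2) t) (fun t => C ((fun t : ℕ => if t = 0 then (1 : ℝ) else if t = 1 then 1 / 2 else 2) (t - 1)) * X ^ (fun t : ℕ => if t = 0 then (1 : ℕ) else if t = 1 then 0 else 2) (t - 1)) 3)).det).eval ((-1 : ℝ) * z)) (-(29 / 100 : ℝ)) ∧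
      0 < (1 : ℝ) * (fun z : ℝ => (((ctPath (fun t => (X : ℝ[X]) ^ (fun t : ℕ => if t = 2 then (1 : ℕ) else 0) t) (fun t => C ((fun t : ℕ => if t = 0 then (1 : ℝ) else if t = 1 then 1 / 2 else 2) t) * X ^ (fun t : ℕ => if t = 0 then (1 : ℕ) else if t = 1 then 0 else 2) t) (fun t => C ((fun t : ℕ => if t = 0 then (1 : ℝ) else if t = 1 then 1 / 2 else 2) (t - 1)) * X ^ (fun t : ℕ => if t = 0 then (1 : ℕ) else if t = 1 then 0 else 2) (t - 1)) 3)).det).eval ((-1 : ℝ) * z)) (-(7 / 25 : ℝ)) ∧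
      (1 : ℝ) * (fun z : ℝ => (((ctPath (fun t => (X : ℝ[X]) ^ (fun t : ℕ => if t = 2 then (1 : ℕ) else 0) t) (fun t => C ((fun t : ℕ => if t = 0 then (1 : ℝ) else if t = 1 then 1 / 2 else 2) t) * X ^ (fun t : ℕ => if t = 0 then (1 : ℕ) else if t = 1 then 0 else 2) t) (fun t => C ((fun t : ℕ => if t = 0 then (1 : ℝ) else if t = 1 then 1 / 2 else 2) (t - 1)) * X ^ (fun t : ℕ => if t = 0 then (1 : ℕ) else if t = 1 then 0 else 2) (t - 1)) 3)).det).eval ((-1 : ℝ) * z)) (-(1 / 5 : ℝ)) < 0 ∧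
      (∀ z ∈ Set.Icc (-(6 / 5 : ℝ)) (-(9 / 10 : ℝ)), (1 : ℝ) * (fun z : ℝ => (((ctPath (fun t => (X : ℝ[X]) ^ (fun t : ℕ => if t = 2 then (1 : ℕ) else 0) t) (fun t => C ((fun t : ℕ => if t = 0 then (1 : ℝ) else if t = 1 then 1 / 2 else 2) t) * X ^ (fun t : ℕ => if t = 0 then (1 : ℕ) else if t = 1 then 0 else 2) t) (fun t => C ((fun t : ℕ => if t = 0 then (1 : ℝ) else if t = 1 then 1 / 2 else 2) (t - 1)) * X ^ (fun t : ℕ => if t = 0 then (1 : ℕ) else if t = 1 then 0 else 2) (t - 1)) 3)).det).eval ((-1 : ℝ) * z)) z < 0) ∧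
      (∀ z ∈ Set.Icc (-(29 / 100 : ℝ)) (-(1 / 5 : ℝ)), (1 : ℝ) * (fun z : ℝ => (((ctPath (fun t => (X : ℝ[X]) ^ (fun t : ℕ => if t = 2 then (1 : ℕ) else 0) t) (fun t => C ((fun t : ℕ => if t = 0 then (1 : ℝ) else if t = 1 then 1 / 2 else 2) t) * X ^ (fun t : ℕ => if t = 0 then (1 : ℕ) else if t = 1 then 0 else 2) t) (fun t => C ((fun t : ℕ => if t = 0 then (1 : ℝ) else if t = 1 then 1 / 2 else 2) (t - 1)) * X ^ (fun t : ℕ => if t = 0 then (1 : ℕ) else if t = 1 then 0 else 2) (t - 1)) 4)).det).eval ((-1 : ℝ) * z)) z < 0) := by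
  simp only [neg_mul, one_mul, neg_neg, eval_det_pbase_three, eval_det_pbase_four, List.nil_append]
  refine ⟨?_, by norm_num, by norm_num, by norm_num, by simp, by norm_num, ?_, by norm_num, by norm_num, ?_, by norm_num, ?_,
    by norm_num, by norm_num, by norm_num, ?_, ?_⟩
  · simp only [List.nil_append, List.isChain_cons_cons, List.cons_append, List.isChain_singleton, and_true]
    norm_num
  · simp only [List.cons_append, List.nil_append, List.isChain_cons_cons, List.isChain_singleton, and_true]
    norm_num
  · simp only [List.isChain_cons_cons, List.isChain_singleton, and_true]
    norm_num
  · intro t ht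
    simp only [List.mem_singleton] at ht
    rw [ht]; norm_num
  · intro z hz
    have := pbase_three_neg (u := -z) ⟨by linarith [hz.2], by linarith [hz.1]⟩
    linarith
  · intro z hz
    have := pbase_four_neg (u := -z) ⟨by linarith [hz.2], by linarith [hz.1]⟩
    linarith

end Summit.ValiantsHypothesis.ValiantsHypothesis.Theorems.KPlusLogSqLaw.StaticTridiagonalRealLadder
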